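import Mathlib
import Literature.NumberTheory.LFunctions.Zhang2022.Section11WindowSj
import HarnessLib

/-!
# Zhang (2022) §12 p. 67 / §7 Prop. 7.1: short multiplicative windows of the weights of `S_j` —
# the `(θ − 1)`-gain for `Σ_{A<d≤θA} Λc(d)`, `Σ_{A<dr<θA} |μ(r)|Λc(d)Λc(r)/(drφ(r))` and the diagonal
# `ξ₀ⱼ`-sum

Topic `Literature/NumberTheory/LFunctions/Zhang2022` (Landau–Siegel audit tree; verdict-neutral).
Y. Zhang, *Discrete mean estimates and the Landau–Siegel zero*, arXiv:2211.02515v1 (2022)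
[Zhang2022LandauSiegel] — **an unrefereed manuscript under adjudication; nothing here asserts or denies
its Theorems 1–2.** ZHANG-L discharge lane, WP12 (binder `h128 : Typed.Sec12A.Eq128 c′` of
`Skeleton.theorem1_of_leaves_v22`, GAP row G-d42-3 (ii): the unprinted input "`S_j(𝐜̄,𝐜) = o(α𝔞)`" for the
dual-side window sequence `𝐜` of (12.8), p. 67; and its twin for (12.6), G-d42-2).

Why this file exists. For a sequence supported on ONE multiplicative window `(x e^{−𝓛⁻¹⁰}, x e^{𝓛⁻¹⁰})`
with values of size `≍ 1` (the smooth-minus-sharp cutoff mismatch of (12.8) at `n ≍ P″₂`), the arithmetic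
sum `S_j` of Proposition 7.1 is of the size of its DIAGONAL `≍ Σ|c(n)|²/n ≍ 𝓛⁻¹⁰`, which is `o(α𝔞)`
(`α = π𝓛⁻⁹`) by exactly one power of `𝓛`: the absolute-value bound `‖S_j‖ ≤ C·B²𝓛⁸` of the tree
(`WindowSj.norm_Sj_window_le`, built for coefficients of size `𝓛⁻¹⁰`) cannot be used, and no logarithm may
be lost anywhere. The bookkeeping therefore needs window sums of the WEIGHTS with the gain `θ − 1` of the
window ratio `θ` kept explicit — this file (elementary, from the tree's squarefree-kernel identity
`Λc = 1 ∗ h`, `XiZeroMajorant.LamC_eq_sum_divisors_sqfreeKernel`):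

* `sum_inv_window_le_log` — `Σ_{a<l≤b} 1/l ≤ 1 + log(b/a)`;
* `sum_mul_LamC_eq_swap` — `Σ_{d∈S} w(d)Λc(d) = Σ_k h(k)·Σ_{l: kl∈S} w(kl)`;
* `sum_sqfreeKernel_le` — `Σ_{k≤X} h(k) ≤ e^{48+12S₀}(1 + log X)^{12}`;
* `sum_LamC_div_window_le_log` — `Σ_{A<d≤B} Λc(d)/d ≤ e^{12+6S₀}(1 + log(B/A))`;
* `sum_LamC_window_le` — `Σ_{A<d≤B} Λc(d) ≤ e^{12+6S₀}(B − A) + e^{48+12S₀}(1 + log B)^{12}`;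
* `sum_moebius_LamC_div_totient_le` — `Σ_{r≤Z} |μ(r)|Λc(r)/φ(r) ≤ e^{30+14S₀}(1 + log Z)`;
* `sum_weight_window_le` — **`Σ_{d,r<N, A<dr<θA} |μ(r)|Λc(d)Λc(r)/(drφ(r)) ≤ (θ−1)e^{12+6S₀}e^{14+7S₀}
  + e^{48+12S₀}e^{30+14S₀}(1+log(θA))^{13}/A`** (`A ≥ 1`, `θ > 1`);
* `sum_gC_div_sq_le` — `Σ_{n≤X} gC(n)/n² ≤ e^{65+7M₀+7(2+S₃)S₄}`;
* `sum_weight_diag_le` — the DIAGONAL of `S_j` on a window `(lo, θlo)` (`lo ≥ 1`, `1 < θ ≤ 2`):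
  `Σ_{d,r,n<N, lo<drn<θlo} |μ(r)|Λc(d)Λc(r)gC(n)/(drφ(r)n²) ≤ (θ−1)·C + (C′(1+log(θlo))^{13} + 1)·(Σ_{n<N}gC(n)/n)/lo`.

No definitions; no statement about Landau–Siegel zeros is made or implied.

## References

* Y. Zhang, arXiv:2211.02515v1 (2022), §7 Prop. 7.1 p. 33; §12 pp. 66–68.
  [cite: Zhang2022LandauSiegel, §7 Prop. 7.1 p.33; §12 (12.6)–(12.8) p.67]
* R. R. Hall, G. Tenenbaum, *Divisors* (CUP 1988), (0.4). [cite: HallTenenbaum1988, (0.4)]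
-/

noncomputable section

open Finset Real ArithmeticFunction

namespace Literature.NumberTheory.LFunctions.Zhang2022.ThinWindow

open XiZeroMajorant MeanSquareMajorant

/-! ### Part 1. The harmonic sum over a window -/

/-- `Σ_{k ≤ n} 1/k ≤ 1 + log n` (Mathlib's `harmonic_le_one_add_log`, real form) and
`log(n+1) ≤ Σ_{k≤n} 1/k`. [folklore] -/
private theorem harmonic_bounds (n : ℕ) :
    Real.log ((n : ℝ) + 1) ≤ ∑ k ∈ Icc 1 n, (1 : ℝ) / k ∧
      ∑ k ∈ Icc 1 n, (1 : ℝ) / k ≤ 1 + Real.log n := by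
  have e : ∑ k ∈ Icc 1 n, (1 : ℝ) / k = (harmonic n : ℝ) := by
    rw [harmonic_eq_sum_Icc]; push_cast
    refine sum_congr rfl fun k _ => ?_
    rw [one_div]
  rw [e]
  refine ⟨?_, harmonic_le_one_add_log n⟩
  have h := log_add_one_le_harmonic n
  push_cast at h
  exact h

/-- **`Σ_{a < l ≤ b} 1/l ≤ 1 + log(b/a)`** for reals `0 < a ≤ b` and any finite set of integers `l ≥ 1`
in `(a, b]` (integral comparison of the harmonic sum). [cite: MontgomeryVaughan2007, §1.3] -/
theorem sum_inv_window_le_log {a b : ℝ} (ha : 0 < a) (hab : a ≤ b) (S : Finset ℕ)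
    (hS : ∀ l ∈ S, 1 ≤ l ∧ a < l ∧ (l : ℝ) ≤ b) :
    ∑ l ∈ S, (1 : ℝ) / l ≤ 1 + Real.log (b / a) := by
  have hb : 0 < b := lt_of_lt_of_le ha hab
  -- `S ⊆ Icc (⌊a⌋₊ + 1) ⌊b⌋₊`
  have hsub : S ⊆ Icc (⌊a⌋₊ + 1) ⌊b⌋₊ := by
    intro l hl
    obtain ⟨hl1, hal, hlb⟩ := hS l hl
    rw [mem_Icc]
    refine ⟨?_, Nat.le_floor hlb⟩
    have : ⌊a⌋₊ < l := (Nat.floor_lt ha.le).mpr hal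
    omega
  have h1 : ∑ l ∈ S, (1 : ℝ) / l ≤ ∑ l ∈ Icc (⌊a⌋₊ + 1) ⌊b⌋₊, (1 : ℝ) / l :=
    sum_le_sum_of_subset_of_nonneg hsub fun l _ _ => by positivity
  refine h1.trans ?_
  rcases Nat.lt_or_ge ⌊b⌋₊ (⌊a⌋₊ + 1) with hlt | hge
  · rw [Icc_eq_empty (by omega), sum_empty]
    have : 0 ≤ Real.log (b / a) := Real.log_nonneg ((one_le_div ha).mpr hab)
    linarith
  · -- difference of two harmonic sums
    have hsplit : ∑ l ∈ Icc 1 ⌊b⌋₊, (1 : ℝ) / l =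
        ∑ l ∈ Icc 1 ⌊a⌋₊, (1 : ℝ) / l + ∑ l ∈ Icc (⌊a⌋₊ + 1) ⌊b⌋₊, (1 : ℝ) / l := by
      rw [← sum_union]
      · congr 1
        ext l; simp only [mem_union, mem_Icc]; omega
      · rw [disjoint_left]; intro l h1 h2; rw [mem_Icc] at h1 h2; omega
    have hB := (harmonic_bounds ⌊b⌋₊).2
    have hA := (harmonic_bounds ⌊a⌋₊).1
    have hfloorb : Real.log (⌊b⌋₊ : ℝ) ≤ Real.log b := by
      have hb1 : (1 : ℝ) ≤ ⌊b⌋₊ := by exact_mod_cast (by omega : 1 ≤ ⌊b⌋₊)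
      exact Real.log_le_log (by linarith) (Nat.floor_le hb.le)
    have hfloora : Real.log a ≤ Real.log ((⌊a⌋₊ : ℝ) + 1) :=
      Real.log_le_log ha (Nat.lt_floor_add_one a).le
    rw [Real.log_div hb.ne' ha.ne']
    linarith

/-! ### Part 2. The squarefree kernel `h` of `Λc = 1 ∗ h` and the swap of sums -/

/-- **`Σ_{d∈S} w(d)Λc(d) = Σ_{k≤K} h(k)·Σ_{l≤K, kl∈S} w(kl)`** for `S ⊆ [1, K]` (`h` = the squarefree kernel
of `Λc`, tree `LamC_eq_sum_divisors_sqfreeKernel`; every `d ∈ S` is written `d = kl` with `k ∣ d`).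
[cite: Zhang2022LandauSiegel, §7 p.33] -/
theorem sum_mul_LamC_eq_swap (S : Finset ℕ) (K : ℕ) (hS : ∀ d ∈ S, 1 ≤ d ∧ d ≤ K) (w : ℕ → ℝ) :
    ∑ d ∈ S, w d * LamC d =
      ∑ k ∈ Icc 1 K, (if Squarefree k then ∏ p ∈ k.primeFactors, 12 / (p : ℝ) else 0) *
        ∑ l ∈ (Icc 1 K).filter (fun l => k * l ∈ S), w (k * l) := by
  classical
  -- expand `Λc(d)` and extend the divisor sum to `k ≤ K` with an indicator
  have h1 : ∀ d ∈ S, w d * LamC d =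
      ∑ k ∈ Icc 1 K, (if k ∣ d then
        (if Squarefree k then ∏ p ∈ k.primeFactors, 12 / (p : ℝ) else 0) * w d else 0) := by
    intro d hd
    obtain ⟨hd1, hdK⟩ := hS d hd
    rw [LamC_eq_sum_divisors_sqfreeKernel, mul_sum, ← sum_filter]
    have hset : (Icc 1 K).filter (fun k => k ∣ d) = d.divisors := by
      ext k
      rw [mem_filter, mem_Icc, Nat.mem_divisors]
      constructor
      · rintro ⟨-, hk⟩; exact ⟨hk, by omega⟩
      · rintro ⟨hk, hd0⟩
        have := Nat.le_of_dvd (by omega) hk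
        exact ⟨⟨Nat.pos_of_dvd_of_pos hk (by omega), by omega⟩, hk⟩
    rw [hset]
    exact sum_congr rfl fun k _ => by ring
  rw [sum_congr rfl h1, sum_comm]
  refine sum_congr rfl fun k hk => ?_
  have hk1 : 1 ≤ k := (mem_Icc.mp hk).1
  rw [← sum_filter, mul_sum]
  -- reindex the multiples of `k` in `S` by `l = d / k`
  have hset : S.filter (fun d => k ∣ d) = ((Icc 1 K).filter (fun l => k * l ∈ S)).image (k * ·) := by
    ext d
    rw [mem_filter, mem_image]
    constructor
    · rintro ⟨hdS, ⟨l, rfl⟩⟩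
      obtain ⟨h1', hK'⟩ := hS _ hdS
      refine ⟨l, ?_, rfl⟩
      rw [mem_filter, mem_Icc]
      refine ⟨⟨?_, ?_⟩, hdS⟩
      · rcases Nat.eq_zero_or_pos l with rfl | hl
        · simp at h1'
        · exact hl
      · exact le_trans (Nat.le_mul_of_pos_left l (by omega)) hK'
    · rintro ⟨l, hl, rfl⟩
      rw [mem_filter] at hl
      exact ⟨hl.2, dvd_mul_right k l⟩
  rw [hset, sum_image]
  · intro l₁ _ l₂ _ h
    exact Nat.eq_of_mul_eq_mul_left (by omega) h

/-- **`Σ_{k≤X} h(k) ≤ e^{48+12S₀}(1 + log X)^{12}`** for every `X` (the Euler-product majorant, tree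
`sum_div_le_gen`, for the multiplicative `k ↦ k·h(k)`: value `12` at primes, `0` at higher powers).
[cite: HallTenenbaum1988, (0.4)] -/
theorem sum_sqfreeKernel_le (X : ℕ) :
    ∑ k ∈ Icc 1 X, (if Squarefree k then ∏ p ∈ k.primeFactors, 12 / (p : ℝ) else 0) ≤
      Real.exp (48 + 12 * LogEulerProduct.tailConst 0) * (1 + Real.log X) ^ 12 := by
  have hS0 := LogEulerProduct.tailConst_nonneg 0
  rcases Nat.lt_or_ge X 2 with hX | hX
  · interval_cases X
    · simp; positivity
    · rw [show Icc 1 1 = {1} by rfl, sum_singleton]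
      simp only [squarefree_one, ↓reduceIte, Nat.primeFactors_one, prod_empty, Nat.cast_one,
        Real.log_one, add_zero, one_pow, mul_one]
      exact Real.one_le_exp (by positivity)
  · -- `f(k) = k·h(k)` is multiplicative with `f(p) = 12`, `f(p^ν) = 0` (`ν ≥ 2`)
    set f : ℕ → ℝ := fun k => (k : ℝ) *
      (if Squarefree k then ∏ p ∈ k.primeFactors, 12 / (p : ℝ) else 0) with hf
    have hf0 : ∀ k, 0 ≤ f k := fun k => mul_nonneg (Nat.cast_nonneg k) (sqfreeKernel_nonneg k)
    have hf1 : f 1 = 1 := by simp [hf]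
    have hfmul : ∀ m n : ℕ, Nat.Coprime m n → f (m * n) = f m * f n := by
      intro m n hmn
      rcases eq_or_ne m 0 with rfl | hm
      · have : n = 1 := by
          have := Nat.Coprime.eq_one_of_dvd (Nat.Coprime.symm hmn) (dvd_zero n); exact this
        subst this; simp [hf]
      rcases eq_or_ne n 0 with rfl | hn
      · have : m = 1 := Nat.Coprime.eq_one_of_dvd hmn (dvd_zero m)
        subst this; simp [hf]
      simp only [hf]
      rw [sqfreeKernel_mul_of_coprime hm hn hmn]; push_cast; ring
    have hfp : ∀ p : ℕ, p.Prime → f p = 12 := by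
      intro p hp
      have hp0 : (p : ℝ) ≠ 0 := by exact_mod_cast hp.ne_zero
      simp only [hf, hp.squarefree, ↓reduceIte, hp.primeFactors, prod_singleton]
      field_simp
    have hfpow : ∀ p ν : ℕ, p.Prime → f (p ^ ν) ≤ 12 * ((ν : ℝ) + 1) ^ 0 := by
      intro p ν hp
      rw [pow_zero, mul_one]
      rcases Nat.lt_or_ge ν 2 with hν | hν
      · interval_cases ν
        · simp [hf]
        · rw [pow_one, hfp p hp]
      · have hns : ¬ Squarefree (p ^ ν) := by
          rw [Nat.squarefree_pow_iff hp.ne_one (by omega)]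
          rintro ⟨-, h⟩; omega
        simp only [hf, hns, ↓reduceIte, mul_zero]; norm_num
    have hsum : ∀ p : ℕ, p.Prime → Summable (fun ν : ℕ => f (p ^ ν) / (p : ℝ) ^ ν) := by
      intro p hp
      refine summable_of_ne_finset_zero (s := Finset.range 2) fun ν hν => ?_
      rw [Finset.mem_range, not_lt] at hν
      have hns : ¬ Squarefree (p ^ ν) := by
        rw [Nat.squarefree_pow_iff hp.ne_one (by omega)]
        rintro ⟨-, h⟩; omega
      simp [hf, hns]
    have h := sum_div_le_gen (f := f) hf1 hfmul hf0 (a := 12) (d := 0) (K := 0) (M := 0) (C₅ := 12)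
      le_rfl le_rfl (by norm_num) hX hsum
      (fun p hp _ => by rw [hfp p hp]; push_cast; simp)
      (fun p ν hp _ => hfpow p ν hp)
    have e : ∀ k ∈ Icc 1 X, (if Squarefree k then ∏ p ∈ k.primeFactors, 12 / (p : ℝ) else 0) =
        f k / k := by
      intro k hk
      have hk0 : (k : ℝ) ≠ 0 := by exact_mod_cast (by have := (mem_Icc.mp hk).1; omega : k ≠ 0)
      simp only [hf]; field_simp
    rw [sum_congr rfl e]
    refine h.trans ?_
    have hlog0 : 0 ≤ Real.log X := Real.log_natCast_nonneg X
    have e2 : Real.exp (4 * ((12 : ℕ) : ℝ) + 0 * Real.log (4 * X) + 0 +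
        12 * LogEulerProduct.tailConst 0) = Real.exp (48 + 12 * LogEulerProduct.tailConst 0) := by
      congr 1; push_cast; ring
    rw [e2]
    gcongr
    linarith

/-! ### Part 3. Window sums of `Λc` -/

/-- **`Σ_{A<d≤B} Λc(d)/d ≤ e^{12+6S₀}(1 + log(B/A))`** for reals `0 < A ≤ B` and any finite set of
integers `d ≥ 1` in `(A, B]` (swap to the squarefree kernel: the `l`-sum is a harmonic window
`≤ 1 + log(B/A)`, and `Σ_k h(k)/k ≤ e^{12+6S₀}`, tree `sum_sqfreeKernel_div_le`).
[cite: Zhang2022LandauSiegel, §7 p.33; §12 p.67] -/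
theorem sum_LamC_div_window_le_log {A B : ℝ} (hA : 0 < A) (hAB : A ≤ B) (S : Finset ℕ)
    (hS : ∀ d ∈ S, 1 ≤ d ∧ A < d ∧ (d : ℝ) ≤ B) :
    ∑ d ∈ S, LamC d / d ≤
      Real.exp (12 + 6 * LogEulerProduct.tailConst 0) * (1 + Real.log (B / A)) := by
  classical
  set E : ℝ := Real.exp (12 + 6 * LogEulerProduct.tailConst 0) with hE
  have hB : 0 < B := lt_of_lt_of_le hA hAB
  have hlog : 0 ≤ 1 + Real.log (B / A) := by
    have : 0 ≤ Real.log (B / A) := Real.log_nonneg ((one_le_div hA).mpr hAB); linarith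
  set K : ℕ := ⌊B⌋₊ with hK
  have hSK : ∀ d ∈ S, 1 ≤ d ∧ d ≤ K := fun d hd =>
    ⟨(hS d hd).1, Nat.le_floor (hS d hd).2.2⟩
  have hswap := sum_mul_LamC_eq_swap S K hSK (fun d => 1 / (d : ℝ))
  have e1 : ∑ d ∈ S, LamC d / d = ∑ d ∈ S, 1 / (d : ℝ) * LamC d :=
    sum_congr rfl fun d _ => by ring
  rw [e1, hswap]
  -- the inner `l`-sums
  have hinner : ∀ k ∈ Icc 1 K,
      ∑ l ∈ (Icc 1 K).filter (fun l => k * l ∈ S), 1 / ((k * l : ℕ) : ℝ) ≤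
        1 / (k : ℝ) * (1 + Real.log (B / A)) := by
    intro k hk
    have hk1 : 1 ≤ k := (mem_Icc.mp hk).1
    have hk0 : (0 : ℝ) < k := by exact_mod_cast hk1
    have e2 : ∑ l ∈ (Icc 1 K).filter (fun l => k * l ∈ S), 1 / ((k * l : ℕ) : ℝ) =
        1 / (k : ℝ) * ∑ l ∈ (Icc 1 K).filter (fun l => k * l ∈ S), 1 / (l : ℝ) := by
      rw [mul_sum]
      refine sum_congr rfl fun l _ => ?_
      push_cast
      rw [one_div_mul_one_div]
    rw [e2]
    refine mul_le_mul_of_nonneg_left ?_ (by positivity)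
    have hBA : B / k / (A / k) = B / A := by field_simp
    rw [← hBA]
    refine sum_inv_window_le_log (a := A / k) (b := B / k) (by positivity)
      (div_le_div_of_nonneg_right hAB hk0.le) _ fun l hl => ?_
    rw [mem_filter, mem_Icc] at hl
    obtain ⟨⟨hl1, -⟩, hklS⟩ := hl
    obtain ⟨-, hAkl, hklB⟩ := hS _ hklS
    push_cast at hAkl hklB
    refine ⟨hl1, ?_, ?_⟩
    · rw [div_lt_iff₀ hk0]; linarith [mul_comm (k : ℝ) l]
    · rw [le_div_iff₀ hk0]; linarith [mul_comm (k : ℝ) l]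
  calc ∑ k ∈ Icc 1 K, (if Squarefree k then ∏ p ∈ k.primeFactors, 12 / (p : ℝ) else 0) *
          ∑ l ∈ (Icc 1 K).filter (fun l => k * l ∈ S), 1 / ((k * l : ℕ) : ℝ)
      ≤ ∑ k ∈ Icc 1 K, (if Squarefree k then ∏ p ∈ k.primeFactors, 12 / (p : ℝ) else 0) *
          (1 / (k : ℝ) * (1 + Real.log (B / A))) :=
        sum_le_sum fun k hk => mul_le_mul_of_nonneg_left (hinner k hk) (sqfreeKernel_nonneg k)
    _ = (∑ k ∈ Icc 1 K, (if Squarefree k then ∏ p ∈ k.primeFactors, 12 / (p : ℝ) else 0) / k) *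
          (1 + Real.log (B / A)) := by
        rw [sum_mul]; refine sum_congr rfl fun k _ => ?_; ring
    _ ≤ E * (1 + Real.log (B / A)) := by
        refine mul_le_mul_of_nonneg_right ?_ hlog
        rcases Nat.lt_or_ge K 2 with hK2 | hK2
        · have hE1 : 1 ≤ E := Real.one_le_exp (by positivity [LogEulerProduct.tailConst_nonneg 0])
          interval_cases K
          · simp; positivity
          · rw [show Icc 1 1 = {1} by rfl, sum_singleton]
            simp only [squarefree_one, ↓reduceIte, Nat.primeFactors_one, prod_empty, Nat.cast_one,
              div_one]
            exact hE1
        · exact sum_sqfreeKernel_div_le hK2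

/-- **`Σ_{A<d≤B} Λc(d) ≤ e^{12+6S₀}(B − A) + e^{48+12S₀}(1 + log B)^{12}`** for reals `0 ≤ A ≤ B`, `B ≥ 1`, any finite
set of integers `d ≥ 1` in `(A, B]` (swap to the squarefree kernel: `#{l : A < kl ≤ B} ≤ (B − A)/k + 1`,
then `Σ_k h(k)/k ≤ e^{12+6S₀}` and `Σ_{k≤B} h(k) ≤ e^{48+12S₀}(1+log B)^{12}`) — the short-interval mean of
`Λc` with the gain `B − A` explicit. [cite: Zhang2022LandauSiegel, §7 p.33; §12 p.67] -/
theorem sum_LamC_window_le {A B : ℝ} (hA : 0 ≤ A) (hAB : A ≤ B) (hB1 : 1 ≤ B) (S : Finset ℕ)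
    (hS : ∀ d ∈ S, 1 ≤ d ∧ A < d ∧ (d : ℝ) ≤ B) :
    ∑ d ∈ S, LamC d ≤
      Real.exp (12 + 6 * LogEulerProduct.tailConst 0) * (B - A) +
        Real.exp (48 + 12 * LogEulerProduct.tailConst 0) * (1 + Real.log B) ^ 12 := by
  classical
  set E : ℝ := Real.exp (12 + 6 * LogEulerProduct.tailConst 0) with hE
  set E' : ℝ := Real.exp (48 + 12 * LogEulerProduct.tailConst 0) with hE'
  set K : ℕ := ⌊B⌋₊ with hK
  have hSK : ∀ d ∈ S, 1 ≤ d ∧ d ≤ K := fun d hd =>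
    ⟨(hS d hd).1, Nat.le_floor (hS d hd).2.2⟩
  have hswap := sum_mul_LamC_eq_swap S K hSK (fun _ => (1 : ℝ))
  simp only [one_mul] at hswap
  rw [hswap]
  -- the inner counts
  have hinner : ∀ k ∈ Icc 1 K,
      ∑ l ∈ (Icc 1 K).filter (fun l => k * l ∈ S), (1 : ℝ) ≤ (B - A) / k + 1 := by
    intro k hk
    have hk1 : 1 ≤ k := (mem_Icc.mp hk).1
    have hk0 : (0 : ℝ) < k := by exact_mod_cast hk1
    rw [sum_const, nsmul_eq_mul, mul_one]
    -- the `l` with `A < kl ≤ B` lie in `Icc (⌊A/k⌋₊ + 1) ⌊B/k⌋₊`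
    have hsub : (Icc 1 K).filter (fun l => k * l ∈ S) ⊆ Icc (⌊A / k⌋₊ + 1) ⌊B / k⌋₊ := by
      intro l hl
      rw [mem_filter] at hl
      obtain ⟨-, hklS⟩ := hl
      obtain ⟨-, hAkl, hklB⟩ := hS _ hklS
      push_cast at hAkl hklB
      rw [mem_Icc]
      constructor
      · have : ⌊A / k⌋₊ < l := by
          refine (Nat.floor_lt (by positivity)).mpr ?_
          rw [div_lt_iff₀ hk0]; linarith [mul_comm (k : ℝ) l]
        omega
      · refine Nat.le_floor ?_
        rw [le_div_iff₀ hk0]; linarith [mul_comm (k : ℝ) l]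
    have hcard := card_le_card hsub
    rw [Nat.card_Icc] at hcard
    have h1 : (((Icc 1 K).filter (fun l => k * l ∈ S)).card : ℝ) ≤
        ((⌊B / k⌋₊ + 1 - (⌊A / k⌋₊ + 1) : ℕ) : ℝ) := by exact_mod_cast hcard
    refine h1.trans ?_
    have hfB : (⌊B / k⌋₊ : ℝ) ≤ B / k := Nat.floor_le (by
      have : 0 ≤ B := hA.trans hAB; positivity)
    have hfA : A / k < (⌊A / k⌋₊ : ℝ) + 1 := Nat.lt_floor_add_one _
    have hsub' : ((⌊B / k⌋₊ + 1 - (⌊A / k⌋₊ + 1) : ℕ) : ℝ) ≤ (⌊B / k⌋₊ : ℝ) - ⌊A / k⌋₊ := by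
      rcases le_or_gt (⌊A / k⌋₊ + 1) (⌊B / k⌋₊ + 1) with h | h
      · rw [Nat.cast_sub h]; push_cast; linarith
      · rw [Nat.sub_eq_zero_of_le h.le]; push_cast
        -- here `⌊B/k⌋ < ⌊A/k⌋` is impossible since `A ≤ B`, but `0 ≤ rhs` suffices? use monotonicity
        have : (⌊A / k⌋₊ : ℝ) ≤ ⌊B / k⌋₊ := by
          exact_mod_cast Nat.floor_le_floor (div_le_div_of_nonneg_right hAB hk0.le)
        linarith
    refine hsub'.trans ?_
    rw [sub_div]
    linarith
  calc ∑ k ∈ Icc 1 K, (if Squarefree k then ∏ p ∈ k.primeFactors, 12 / (p : ℝ) else 0) *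
          ∑ l ∈ (Icc 1 K).filter (fun l => k * l ∈ S), (1 : ℝ)
      ≤ ∑ k ∈ Icc 1 K, (if Squarefree k then ∏ p ∈ k.primeFactors, 12 / (p : ℝ) else 0) *
          ((B - A) / k + 1) :=
        sum_le_sum fun k hk => mul_le_mul_of_nonneg_left (hinner k hk) (sqfreeKernel_nonneg k)
    _ = (B - A) * ∑ k ∈ Icc 1 K, (if Squarefree k then ∏ p ∈ k.primeFactors, 12 / (p : ℝ) else 0) / k +
          ∑ k ∈ Icc 1 K, (if Squarefree k then ∏ p ∈ k.primeFactors, 12 / (p : ℝ) else 0) := by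
        rw [mul_sum, ← sum_add_distrib]
        refine sum_congr rfl fun k _ => ?_; ring
    _ ≤ (B - A) * E + E' * (1 + Real.log K) ^ 12 := by
        have hBA : 0 ≤ B - A := by linarith
        refine add_le_add (mul_le_mul_of_nonneg_left ?_ hBA) (sum_sqfreeKernel_le K)
        rcases Nat.lt_or_ge K 2 with hK2 | hK2
        · have hE1 : 1 ≤ E := Real.one_le_exp (by positivity [LogEulerProduct.tailConst_nonneg 0])
          interval_cases K
          · simp; positivity
          · rw [show Icc 1 1 = {1} by rfl, sum_singleton]
            simp only [squarefree_one, ↓reduceIte, Nat.primeFactors_one, prod_empty, Nat.cast_one,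
              div_one]
            exact hE1
        · exact sum_sqfreeKernel_div_le hK2
    _ ≤ E * (B - A) + E' * (1 + Real.log B) ^ 12 := by
        rw [mul_comm (B - A) E]
        have hK0 : (K : ℝ) ≤ B := Nat.floor_le (by linarith)
        have hKpos : 0 < K := Nat.floor_pos.mpr hB1
        have hlogK : Real.log K ≤ Real.log B := Real.log_le_log (by exact_mod_cast hKpos) hK0
        have h0 : 0 ≤ 1 + Real.log (K : ℝ) := by
          have := Real.log_natCast_nonneg K; linarith
        gcongr

/-! ### Part 4. The weights `|μ(r)|Λc(d)Λc(r)/(drφ(r))` summed over a multiplicative window -/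

/-- **`Σ_{r≤Z} |μ(r)|Λc(r)/φ(r) ≤ e^{30+14S₀}(1 + log Z)`** for every `Z` (Euler-product majorant for the
multiplicative `r ↦ |μ(r)|Λc(r)r/φ(r)`: value `(p+12)/(p−1) ≤ 1 + 26/p` at `p`, `0` at higher powers).
[cite: HallTenenbaum1988, (0.4)] -/
theorem sum_moebius_LamC_div_totient_le (Z : ℕ) :
    ∑ r ∈ Icc 1 Z, ((ArithmeticFunction.moebius r).natAbs : ℝ) * LamC r / (Nat.totient r : ℝ) ≤
      Real.exp (30 + 14 * LogEulerProduct.tailConst 0) * (1 + Real.log Z) := by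
  set E : ℝ := Real.exp (30 + 14 * LogEulerProduct.tailConst 0) with hE
  have hS0 := LogEulerProduct.tailConst_nonneg 0
  have hE1 : 1 ≤ E := Real.one_le_exp (by positivity)
  -- `f(r) = |μ(r)|Λc(r)·r/φ(r)`
  set f : ℕ → ℝ := fun r =>
    ((ArithmeticFunction.moebius r).natAbs : ℝ) * LamC r * r / (Nat.totient r : ℝ) with hf
  have hf0 : ∀ r, 0 ≤ f r := fun r => by positivity [LamC_nonneg r]
  have hf1 : f 1 = 1 := by
    rw [hf]; dsimp only
    rw [isMultiplicative_LamC.map_one, isMultiplicative_moebius.map_one]; simp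
  have hfmul : ∀ m n : ℕ, Nat.Coprime m n → f (m * n) = f m * f n := by
    intro m n hmn
    rw [hf]; dsimp only
    rcases eq_or_ne m 0 with rfl | hm
    · simp [LamC]
    rcases eq_or_ne n 0 with rfl | hn
    · simp [LamC]
    rw [isMultiplicative_moebius.map_mul_of_coprime hmn, Int.natAbs_mul, Nat.cast_mul,
      isMultiplicative_LamC.map_mul_of_coprime hmn, Nat.totient_mul hmn, Nat.cast_mul, Nat.cast_mul]
    have hφm : (Nat.totient m : ℝ) ≠ 0 := by exact_mod_cast (Nat.totient_pos.mpr (by omega)).ne'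
    have hφn : (Nat.totient n : ℝ) ≠ 0 := by exact_mod_cast (Nat.totient_pos.mpr (by omega)).ne'
    field_simp
  -- prime values
  have hfp : ∀ p : ℕ, p.Prime → f p ≤ ((1 : ℕ) : ℝ) + 0 * Real.log p + 26 / p := by
    intro p hp
    have hp2 : (2 : ℝ) ≤ p := by exact_mod_cast hp.two_le
    have hppos : (0 : ℝ) < p := by linarith
    rw [hf]; dsimp only
    rw [moebius_apply_prime hp, LamC_apply hp.ne_zero, hp.primeFactors, prod_singleton,
      Nat.totient_prime hp]
    have hφ : (((p - 1 : ℕ)) : ℝ) = (p : ℝ) - 1 := by rw [Nat.cast_sub hp.one_le]; simp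
    rw [hφ]
    simp only [Int.reduceNeg, Int.natAbs_neg, Int.natAbs_one, Nat.cast_one, one_mul, zero_mul,
      add_zero]
    rw [div_le_iff₀ (by linarith)]
    have e1 : (1 + 12 / (p : ℝ)) * p = p + 12 := by field_simp
    have e2 : (1 + 26 / (p : ℝ)) * (p - 1) = p + 25 - 26 / p := by field_simp; ring
    rw [e1, e2]
    have : 26 / (p : ℝ) ≤ 13 := by rw [div_le_iff₀ hppos]; linarith
    linarith
  have hfpow : ∀ p ν : ℕ, p.Prime → f (p ^ ν) ≤ 14 := by
    intro p ν hp
    have hp2 : (2 : ℝ) ≤ p := by exact_mod_cast hp.two_le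
    rcases Nat.lt_or_ge ν 2 with hν | hν
    · interval_cases ν
      · rw [pow_zero, hf1]; norm_num
      · rw [pow_one]
        refine (hfp p hp).trans ?_
        push_cast
        have : 26 / (p : ℝ) ≤ 13 := by rw [div_le_iff₀ (by linarith)]; linarith
        linarith
    · rw [hf]; dsimp only
      rw [moebius_apply_prime_pow hp (by omega), if_neg (by omega)]
      simp
  have hfsum : ∀ p : ℕ, p.Prime → Summable fun ν : ℕ => f (p ^ ν) / (p : ℝ) ^ ν := by
    intro p hp
    have hp2 : (2 : ℝ) ≤ p := by exact_mod_cast hp.two_le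
    refine Summable.of_nonneg_of_le (fun ν => div_nonneg (hf0 _) (by positivity))
      (fun ν => ?_) ((summable_geometric_of_lt_one (by norm_num : (0 : ℝ) ≤ 1 / 2)
        (by norm_num)).mul_left 14)
    have hppos : (0 : ℝ) < (p : ℝ) ^ ν := by positivity
    rw [div_le_iff₀ hppos]
    have h1 : (1 : ℝ) ≤ (1 / 2 : ℝ) ^ ν * (p : ℝ) ^ ν := by
      rw [← mul_pow]; exact one_le_pow₀ (by linarith)
    calc f (p ^ ν) ≤ 14 := hfpow p ν hp
      _ ≤ 14 * ((1 / 2 : ℝ) ^ ν * (p : ℝ) ^ ν) := le_mul_of_one_le_right (by norm_num) h1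
      _ = 14 * (1 / 2 : ℝ) ^ ν * (p : ℝ) ^ ν := by ring
  have hterm : ∀ r ∈ Icc 1 Z, ((ArithmeticFunction.moebius r).natAbs : ℝ) * LamC r /
      (Nat.totient r : ℝ) = f r / r := by
    intro r hr
    have hr0 : (r : ℝ) ≠ 0 := by exact_mod_cast (by have := (mem_Icc.mp hr).1; omega : r ≠ 0)
    rw [hf]; dsimp only
    field_simp
  rw [sum_congr rfl hterm]
  rcases Nat.lt_or_ge Z 2 with hZ | hZ
  · interval_cases Z
    · simp; positivity
    · rw [show Icc 1 1 = {1} by rfl, sum_singleton, hf1]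
      simp only [Nat.cast_one, div_one, Real.log_one, add_zero, mul_one]
      exact hE1
  · have h := sum_div_le_gen (f := f) hf1 hfmul hf0 (a := 1) (d := 0) (K := 0) (M := 26)
      (C₅ := 14) le_rfl (by norm_num) (by norm_num) hZ hfsum (fun p hp _ => hfp p hp)
      (fun p ν hp _ => by rw [pow_zero, mul_one]; exact hfpow p ν hp)
    have e : Real.exp (4 * ((1 : ℕ) : ℝ) + 0 * Real.log (4 * Z) + 26 +
        14 * LogEulerProduct.tailConst 0) * Real.log Z ^ (1 : ℕ) = E * Real.log Z := by
      rw [hE, pow_one]; congr 1; push_cast; ring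
    rw [e] at h
    have hlog : 0 ≤ Real.log Z := Real.log_natCast_nonneg Z
    nlinarith

/-- The `d`-sum of the window weight at fixed `r ≥ 1`: for `A ≥ 1`, `1 < θ`,
`Σ_{d<N, A<dr<θA} Λc(d)/d ≤ [r < θA]·(e^{12+6S₀}(θ − 1) + (r/A)e^{48+12S₀}(1 + log(θA))^{12})`
(`1/d < r/A` on the window and `sum_LamC_window_le` on `(A/r, θA/r]`).
[cite: Zhang2022LandauSiegel, §7 p.33; §12 p.67] -/
theorem sum_LamC_div_mul_ite_le (N : ℕ) {A θ : ℝ} (hA : 1 ≤ A) (hθ1 : 1 < θ)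
    {r : ℕ} (hr : 1 ≤ r) :
    ∑ d ∈ Ico 1 N, LamC d / d *
        (if A < ((d * r : ℕ) : ℝ) ∧ ((d * r : ℕ) : ℝ) < θ * A then (1 : ℝ) else 0) ≤
      if (r : ℝ) < θ * A then
        Real.exp (12 + 6 * LogEulerProduct.tailConst 0) * (θ - 1) +
          (r : ℝ) / A * (Real.exp (48 + 12 * LogEulerProduct.tailConst 0) * (1 + Real.log (θ * A)) ^ 12)
      else 0 := by
  classical
  set C₃ : ℝ := Real.exp (12 + 6 * LogEulerProduct.tailConst 0) with hC₃
  set E' : ℝ := Real.exp (48 + 12 * LogEulerProduct.tailConst 0) with hE'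
  have hr0 : (0 : ℝ) < r := by exact_mod_cast hr
  have hA0 : 0 < A := by linarith
  simp_rw [mul_boole]
  rw [← sum_filter]
  set S := (Ico 1 N).filter (fun d => A < ((d * r : ℕ) : ℝ) ∧ ((d * r : ℕ) : ℝ) < θ * A) with hSdef
  have hS : ∀ d ∈ S, 1 ≤ d ∧ A / r < d ∧ (d : ℝ) ≤ θ * A / r := by
    intro d hd
    rw [hSdef, mem_filter, mem_Ico] at hd
    obtain ⟨⟨hd1, -⟩, hAd, hdA⟩ := hd
    push_cast at hAd hdA
    refine ⟨hd1, ?_, ?_⟩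
    · rw [div_lt_iff₀ hr0]; linarith
    · rw [le_div_iff₀ hr0]; linarith
  split_ifs with hrA
  · -- `1/d ≤ r/A` on the window
    have h1 : ∑ d ∈ S, LamC d / d ≤ (r : ℝ) / A * ∑ d ∈ S, LamC d := by
      rw [mul_sum]
      refine sum_le_sum fun d hd => ?_
      obtain ⟨hd1, hAd, -⟩ := hS d hd
      have hd0 : (0 : ℝ) < d := by exact_mod_cast hd1
      rw [div_eq_mul_inv, mul_comm ((r : ℝ) / A)]
      refine mul_le_mul_of_nonneg_left ?_ (LamC_nonneg d)
      rw [inv_le_iff_one_le_mul₀ hd0]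
      rw [div_lt_iff₀ hr0] at hAd
      rw [div_mul_eq_mul_div, le_div_iff₀ hA0]
      linarith
    refine h1.trans ?_
    have hB1 : 1 ≤ θ * A / r := by
      rw [le_div_iff₀ hr0]; linarith
    have hAB : A / r ≤ θ * A / r := div_le_div_of_nonneg_right (by nlinarith) hr0.le
    have h2 := sum_LamC_window_le (A := A / r) (B := θ * A / r) (by positivity) hAB hB1 S hS
    have hlogle : (1 + Real.log (θ * A / r)) ^ 12 ≤ (1 + Real.log (θ * A)) ^ 12 := by
      have hl1 : 0 ≤ 1 + Real.log (θ * A / r) := by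
        have := Real.log_nonneg hB1; linarith
      have hl2 : Real.log (θ * A / r) ≤ Real.log (θ * A) := by
        rw [Real.log_div (by nlinarith) hr0.ne']
        have := Real.log_nonneg (show (1 : ℝ) ≤ r by exact_mod_cast hr); linarith
      exact pow_le_pow_left₀ hl1 (by linarith) 12
    calc (r : ℝ) / A * ∑ d ∈ S, LamC d
        ≤ (r : ℝ) / A * (C₃ * (θ * A / r - A / r) + E' * (1 + Real.log (θ * A / r)) ^ 12) :=
          mul_le_mul_of_nonneg_left h2 (by positivity)
      _ ≤ (r : ℝ) / A * (C₃ * (θ * A / r - A / r) + E' * (1 + Real.log (θ * A)) ^ 12) := by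
          gcongr
      _ = C₃ * (θ - 1) + (r : ℝ) / A * (E' * (1 + Real.log (θ * A)) ^ 12) := by
          field_simp
  · -- the window is empty: `d ≥ 1` gives `dr ≥ r ≥ θA`
    have hSe : S = ∅ := by
      rw [eq_empty_iff_forall_notMem]
      intro d hd
      have hd' := hd
      rw [hSdef, mem_filter, mem_Ico] at hd'
      obtain ⟨⟨hd1, -⟩, -, hdA⟩ := hd'
      push_cast at hdA
      have : (r : ℝ) ≤ d * r := by
        have : (1 : ℝ) ≤ d := by exact_mod_cast hd1
        nlinarith
      rw [not_lt] at hrA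
      linarith
    rw [hSe, sum_empty]

/-- **The weight of `S_j` over a multiplicative window** (`A ≥ 1`, `θ > 1`):
`Σ_{d,r<N, A<dr<θA} |μ(r)|Λc(d)Λc(r)/(drφ(r)) ≤ (θ − 1)·e^{12+6S₀}e^{14+7S₀}
+ e^{48+12S₀}e^{30+14S₀}(1 + log(θA))^{13}/A` — the `(θ−1)`-gain that the diagonal of `S_j` needs.
[cite: Zhang2022LandauSiegel, §7 Prop. 7.1 p.33; §12 p.67] -/
theorem sum_weight_window_le (N : ℕ) {A θ : ℝ} (hA : 1 ≤ A) (hθ1 : 1 < θ) :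
    ∑ d ∈ Ico 1 N, ∑ r ∈ Ico 1 N, ((ArithmeticFunction.moebius r).natAbs : ℝ) *
        (LamC d * LamC r) / (((d * r : ℕ) : ℝ) * (Nat.totient r : ℝ)) *
        (if A < ((d * r : ℕ) : ℝ) ∧ ((d * r : ℕ) : ℝ) < θ * A then (1 : ℝ) else 0) ≤
      (θ - 1) * (Real.exp (12 + 6 * LogEulerProduct.tailConst 0) *
          Real.exp (14 + 7 * LogEulerProduct.tailConst 0)) +
        Real.exp (48 + 12 * LogEulerProduct.tailConst 0) *
          Real.exp (30 + 14 * LogEulerProduct.tailConst 0) * (1 + Real.log (θ * A)) ^ 13 / A := by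
  set C₃ : ℝ := Real.exp (12 + 6 * LogEulerProduct.tailConst 0) with hC₃
  set C₄ : ℝ := Real.exp (14 + 7 * LogEulerProduct.tailConst 0) with hC₄
  set E' : ℝ := Real.exp (48 + 12 * LogEulerProduct.tailConst 0) with hE'
  set C₆ : ℝ := Real.exp (30 + 14 * LogEulerProduct.tailConst 0) with hC₆
  have hA0 : 0 < A := by linarith
  have hθA1 : 1 < θ * A := by nlinarith
  have hlog0 : 0 ≤ Real.log (θ * A) := Real.log_nonneg hθA1.le
  have hsubN : Ico 1 N ⊆ Icc 1 N := fun n hn => by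
    rw [mem_Ico] at hn; rw [mem_Icc]; omega
  -- factor the weight and move the `r`-sum outside
  have hterm : ∀ d ∈ Ico 1 N, ∀ r ∈ Ico 1 N,
      ((ArithmeticFunction.moebius r).natAbs : ℝ) * (LamC d * LamC r) /
          (((d * r : ℕ) : ℝ) * (Nat.totient r : ℝ)) *
          (if A < ((d * r : ℕ) : ℝ) ∧ ((d * r : ℕ) : ℝ) < θ * A then (1 : ℝ) else 0) =
        (((ArithmeticFunction.moebius r).natAbs : ℝ) * LamC r / ((r : ℝ) * (Nat.totient r : ℝ))) *
          (LamC d / d *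
            (if A < ((d * r : ℕ) : ℝ) ∧ ((d * r : ℕ) : ℝ) < θ * A then (1 : ℝ) else 0)) := by
    intro d hd r hr
    have hd0 : d ≠ 0 := by have := (mem_Ico.mp hd).1; omega
    have hr0 : r ≠ 0 := by have := (mem_Ico.mp hr).1; omega
    rw [WindowSj.weight_eq hd0 hr0]; ring
  rw [sum_congr rfl fun d hd => sum_congr rfl fun r hr => hterm d hd r hr, sum_comm]
  simp_rw [← mul_sum]
  -- the inner `d`-sums
  have hinner : ∀ r ∈ Ico 1 N,
      ((ArithmeticFunction.moebius r).natAbs : ℝ) * LamC r / ((r : ℝ) * (Nat.totient r : ℝ)) *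
          ∑ d ∈ Ico 1 N, LamC d / d *
            (if A < ((d * r : ℕ) : ℝ) ∧ ((d * r : ℕ) : ℝ) < θ * A then (1 : ℝ) else 0) ≤
        ((ArithmeticFunction.moebius r).natAbs : ℝ) * LamC r / ((r : ℝ) * (Nat.totient r : ℝ)) *
            (C₃ * (θ - 1)) +
          (E' * (1 + Real.log (θ * A)) ^ 12 / A) *
            (((ArithmeticFunction.moebius r).natAbs : ℝ) * LamC r / (Nat.totient r : ℝ) *
              (if (r : ℝ) < θ * A then (1 : ℝ) else 0)) := by
    intro r hr
    have hr1 : 1 ≤ r := (mem_Ico.mp hr).1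
    have hr0 : (r : ℝ) ≠ 0 := by exact_mod_cast (by omega : r ≠ 0)
    have hw0 : 0 ≤ ((ArithmeticFunction.moebius r).natAbs : ℝ) * LamC r /
        ((r : ℝ) * (Nat.totient r : ℝ)) := by positivity [LamC_nonneg r]
    have h := sum_LamC_div_mul_ite_le N hA hθ1 hr1
    refine (mul_le_mul_of_nonneg_left h hw0).trans ?_
    split_ifs with hrA
    · rw [mul_one]
      have e : ((ArithmeticFunction.moebius r).natAbs : ℝ) * LamC r / ((r : ℝ) * (Nat.totient r : ℝ)) *
          ((r : ℝ) / A * (E' * (1 + Real.log (θ * A)) ^ 12)) =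
          E' * (1 + Real.log (θ * A)) ^ 12 / A *
            (((ArithmeticFunction.moebius r).natAbs : ℝ) * LamC r / (Nat.totient r : ℝ)) := by
        field_simp
      rw [mul_add, e]
    · rw [mul_zero, mul_zero, mul_zero, add_zero]
      exact mul_nonneg hw0 (by nlinarith [(Real.exp_pos (12 + 6 * LogEulerProduct.tailConst 0))])
  refine (sum_le_sum hinner).trans ?_
  rw [sum_add_distrib, ← sum_mul, ← mul_sum]
  -- the two `r`-sums
  have hC₄sum : ∑ r ∈ Ico 1 N, ((ArithmeticFunction.moebius r).natAbs : ℝ) * LamC r /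
      ((r : ℝ) * (Nat.totient r : ℝ)) ≤ C₄ :=
    (sum_le_sum_of_subset_of_nonneg hsubN fun r _ _ => by positivity [LamC_nonneg r]).trans
      (sum_moebius_LamC_div_le N)
  have hC₆sum : ∑ r ∈ Ico 1 N, ((ArithmeticFunction.moebius r).natAbs : ℝ) * LamC r /
      (Nat.totient r : ℝ) * (if (r : ℝ) < θ * A then (1 : ℝ) else 0) ≤
      C₆ * (1 + Real.log (θ * A)) := by
    simp_rw [mul_boole]
    rw [← sum_filter]
    have hsub : (Ico 1 N).filter (fun r : ℕ => (r : ℝ) < θ * A) ⊆ Icc 1 ⌊θ * A⌋₊ := by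
      intro r hr
      rw [mem_filter, mem_Ico] at hr
      rw [mem_Icc]
      exact ⟨hr.1.1, Nat.le_floor hr.2.le⟩
    refine (sum_le_sum_of_subset_of_nonneg hsub fun r _ _ => by positivity [LamC_nonneg r]).trans ?_
    refine (sum_moebius_LamC_div_totient_le ⌊θ * A⌋₊).trans ?_
    have hfl : (⌊θ * A⌋₊ : ℝ) ≤ θ * A := Nat.floor_le (by linarith)
    have hflpos : (0 : ℝ) < ⌊θ * A⌋₊ := by exact_mod_cast Nat.floor_pos.mpr hθA1.le
    have : Real.log (⌊θ * A⌋₊ : ℝ) ≤ Real.log (θ * A) := Real.log_le_log hflpos hfl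
    have hC₆0 : 0 ≤ C₆ := (Real.exp_pos _).le
    nlinarith
  have hθ0 : 0 ≤ θ - 1 := by linarith
  calc (∑ r ∈ Ico 1 N, ((ArithmeticFunction.moebius r).natAbs : ℝ) * LamC r /
          ((r : ℝ) * (Nat.totient r : ℝ))) * (C₃ * (θ - 1)) +
        E' * (1 + Real.log (θ * A)) ^ 12 / A *
          ∑ r ∈ Ico 1 N, ((ArithmeticFunction.moebius r).natAbs : ℝ) * LamC r /
            (Nat.totient r : ℝ) * (if (r : ℝ) < θ * A then (1 : ℝ) else 0)
      ≤ C₄ * (C₃ * (θ - 1)) + E' * (1 + Real.log (θ * A)) ^ 12 / A * (C₆ * (1 + Real.log (θ * A))) := by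
        gcongr
    _ = (θ - 1) * (C₃ * C₄) + E' * C₆ * (1 + Real.log (θ * A)) ^ 13 / A := by ring

/-! ### Part 5. The diagonal of `S_j` on a window -/

section Diagonal

variable (c' : ℝ) (D : ℕ)

/-- **`Σ_{n≤X} gC(n)/n² ≤ e^{65+7M₀+7(2+S₃)S₄}`** for every `X` (a convergent Euler product: the tree's
`sum_div_le_gen` for the multiplicative `n ↦ gC(n)/n`, value `≤ (65+7M₀)/p` at `p`).
[cite: HallTenenbaum1988, (0.4)] -/
theorem sum_gC_div_sq_le (X : ℕ) :
    ∑ n ∈ Icc 1 X, gC c' D n / (n : ℝ) ^ 2 ≤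
      Real.exp ((65 + 7 * M0) + 7 * (2 + LogEulerProduct.tailConst 3) * LogEulerProduct.tailConst 4) := by
  set E : ℝ := Real.exp ((65 + 7 * M0) +
    7 * (2 + LogEulerProduct.tailConst 3) * LogEulerProduct.tailConst 4) with hE
  have hT3 := LogEulerProduct.tailConst_nonneg 3
  have hT4 := LogEulerProduct.tailConst_nonneg 4
  have hM0 := M0_nonneg
  have hE1 : 1 ≤ E := Real.one_le_exp (by positivity)
  have hg := isMultiplicative_gC c' D
  set f : ℕ → ℝ := fun n => gC c' D n / n with hf
  have hf0 : ∀ n, 0 ≤ f n := fun n => div_nonneg (gC_nonneg c' D n) (Nat.cast_nonneg n)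
  have hf1 : f 1 = 1 := by simp [hf, hg.map_one]
  have hfmul : ∀ m n : ℕ, Nat.Coprime m n → f (m * n) = f m * f n := by
    intro m n hmn
    simp only [hf]
    rw [hg.map_mul_of_coprime hmn]; push_cast
    rcases eq_or_ne m 0 with rfl | hm
    · simp
    rcases eq_or_ne n 0 with rfl | hn
    · simp
    field_simp
  have hterm : ∀ n ∈ Icc 1 X, gC c' D n / (n : ℝ) ^ 2 = f n / n := by
    intro n hn
    have hn0 : (n : ℝ) ≠ 0 := by exact_mod_cast (by have := (mem_Icc.mp hn).1; omega : n ≠ 0)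
    simp only [hf]; field_simp
  rw [sum_congr rfl hterm]
  rcases Nat.lt_or_ge X 2 with hX | hX
  · interval_cases X
    · simp; positivity
    · rw [show Icc 1 1 = {1} by rfl, sum_singleton, hf1]; simpa using hE1
  · have hfp : ∀ p : ℕ, p.Prime → p ≤ X → f p ≤ ((0 : ℕ) : ℝ) + 0 * Real.log p + (65 + 7 * M0) / p := by
      intro p hp _
      have hp2 : (2 : ℝ) ≤ p := by exact_mod_cast hp.two_le
      have hppos : (0 : ℝ) < p := by linarith
      simp only [hf]
      push_cast
      rw [zero_add, zero_mul, zero_add, div_le_div_iff_of_pos_right hppos]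
      calc gC c' D p ≤ 5 + (60 + 7 * M0) / p := gC_prime_le c' D hp
        _ ≤ 5 + (60 + 7 * M0) / 2 := by gcongr
        _ ≤ 65 + 7 * M0 := by linarith
    have hfpow : ∀ p ν : ℕ, p.Prime → p ≤ X →
        f (p ^ ν) ≤ 7 * (2 + LogEulerProduct.tailConst 3) * ((ν : ℝ) + 1) ^ 4 := by
      intro p ν hp _
      simp only [hf]
      have hp1 : (1 : ℝ) ≤ (p : ℝ) ^ ν := by
        have : (1 : ℝ) ≤ p := by exact_mod_cast hp.one_le
        exact_mod_cast one_le_pow₀ this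
      push_cast
      exact (div_le_self (gC_nonneg c' D _) hp1).trans (gC_prime_pow_le c' D hp ν)
    have hsum : ∀ p : ℕ, p.Prime → Summable (fun ν : ℕ => f (p ^ ν) / (p : ℝ) ^ ν) := by
      intro p hp
      refine Summable.of_nonneg_of_le (fun ν => div_nonneg (hf0 _) (by positivity)) (fun ν => ?_)
        (summable_gC_local c' D hp)
      simp only [hf]
      have hp1 : (1 : ℝ) ≤ (p : ℝ) ^ ν := by
        have : (1 : ℝ) ≤ p := by exact_mod_cast hp.one_le
        exact_mod_cast one_le_pow₀ this
      push_cast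
      exact div_le_div_of_nonneg_right (div_le_self (gC_nonneg c' D _) hp1) (by positivity)
    have h := sum_div_le_gen (f := f) hf1 hfmul hf0 (a := 0) (d := 4) (K := 0) (M := 65 + 7 * M0)
      (C₅ := 7 * (2 + LogEulerProduct.tailConst 3)) le_rfl (by positivity) (by positivity) hX hsum
      hfp hfpow
    have e : Real.exp (4 * ((0 : ℕ) : ℝ) + 0 * Real.log (4 * X) + (65 + 7 * M0) +
        7 * (2 + LogEulerProduct.tailConst 3) * LogEulerProduct.tailConst 4) * Real.log X ^ (0 : ℕ) = E := by
      rw [hE, pow_zero, mul_one]; congr 1; push_cast; ring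
    rw [e] at h
    exact h

/-- **The diagonal of `S_j` on a window.** For `lo ≥ 1`, `1 < θ ≤ 2`:
`Σ_{d,r,n<N, lo<drn<θlo} |μ(r)|Λc(d)Λc(r)gC(n)/(drφ(r)n²) ≤ (θ−1)·C₃C₄·C₂
+ (E′C₆(1+log(θlo))^{13} + 1)/lo·Σ_{n<N} gC(n)/n` (`C₂ = Σ gC/n²`-bound of `sum_gC_div_sq_le`;
for `n ≤ lo` the `(d,r)`-window has `A = lo/n ≥ 1` and `sum_weight_window_le` applies, for
`lo < n < θlo` only `d = r = 1` occurs). [cite: Zhang2022LandauSiegel, §7 Prop. 7.1 p.33; §12 p.67] -/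
theorem sum_weight_diag_le (N : ℕ) {lo θ : ℝ} (hlo : 1 ≤ lo) (hθ1 : 1 < θ) (hθ2 : θ ≤ 2) :
    ∑ d ∈ Ico 1 N, ∑ r ∈ Ico 1 N, ∑ n ∈ Ico 1 N,
        ((ArithmeticFunction.moebius r).natAbs : ℝ) * (LamC d * LamC r) /
            (((d * r : ℕ) : ℝ) * (Nat.totient r : ℝ)) * (gC c' D n / (n : ℝ) ^ 2) *
          (if lo < ((d * r * n : ℕ) : ℝ) ∧ ((d * r * n : ℕ) : ℝ) < θ * lo then (1 : ℝ) else 0) ≤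
      (θ - 1) * (Real.exp (12 + 6 * LogEulerProduct.tailConst 0) *
          Real.exp (14 + 7 * LogEulerProduct.tailConst 0)) *
          Real.exp ((65 + 7 * M0) + 7 * (2 + LogEulerProduct.tailConst 3) * LogEulerProduct.tailConst 4) +
        (Real.exp (48 + 12 * LogEulerProduct.tailConst 0) *
            Real.exp (30 + 14 * LogEulerProduct.tailConst 0) * (1 + Real.log (θ * lo)) ^ 13 + 1) / lo *
          ∑ n ∈ Ico 1 N, gC c' D n / n := by
  set C₃ : ℝ := Real.exp (12 + 6 * LogEulerProduct.tailConst 0) with hC₃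
  set C₄ : ℝ := Real.exp (14 + 7 * LogEulerProduct.tailConst 0) with hC₄
  set E' : ℝ := Real.exp (48 + 12 * LogEulerProduct.tailConst 0) with hE'
  set C₆ : ℝ := Real.exp (30 + 14 * LogEulerProduct.tailConst 0) with hC₆
  set C₂ : ℝ := Real.exp ((65 + 7 * M0) +
    7 * (2 + LogEulerProduct.tailConst 3) * LogEulerProduct.tailConst 4) with hC₂
  have hlo0 : 0 < lo := by linarith
  have hθlo1 : 1 < θ * lo := by nlinarith
  have hlogθlo : 0 ≤ Real.log (θ * lo) := Real.log_nonneg hθlo1.le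
  have hsubN : Ico 1 N ⊆ Icc 1 N := fun n hn => by rw [mem_Ico] at hn; rw [mem_Icc]; omega
  set K : ℝ := E' * C₆ * (1 + Real.log (θ * lo)) ^ 13 + 1 with hK
  have hK0 : 0 ≤ K := by positivity
  -- Step 1: the `n`-sum outside, the weight window at `A = lo/n`
  have e1 : ∀ d ∈ Ico 1 N, ∀ r ∈ Ico 1 N, ∀ n ∈ Ico 1 N,
      ((ArithmeticFunction.moebius r).natAbs : ℝ) * (LamC d * LamC r) /
            (((d * r : ℕ) : ℝ) * (Nat.totient r : ℝ)) * (gC c' D n / (n : ℝ) ^ 2) *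
          (if lo < ((d * r * n : ℕ) : ℝ) ∧ ((d * r * n : ℕ) : ℝ) < θ * lo then (1 : ℝ) else 0) =
        (gC c' D n / (n : ℝ) ^ 2) *
          (((ArithmeticFunction.moebius r).natAbs : ℝ) * (LamC d * LamC r) /
              (((d * r : ℕ) : ℝ) * (Nat.totient r : ℝ)) *
            (if lo / n < ((d * r : ℕ) : ℝ) ∧ ((d * r : ℕ) : ℝ) < θ * (lo / n) then (1 : ℝ) else 0)) := by
    intro d _ r _ n hn
    have hn0 : (0 : ℝ) < n := by exact_mod_cast (mem_Ico.mp hn).1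
    have hiff : (lo < ((d * r * n : ℕ) : ℝ) ∧ ((d * r * n : ℕ) : ℝ) < θ * lo) ↔
        (lo / n < ((d * r : ℕ) : ℝ) ∧ ((d * r : ℕ) : ℝ) < θ * (lo / n)) := by
      push_cast
      rw [div_lt_iff₀ hn0, mul_div_assoc', lt_div_iff₀ hn0]
    rw [if_congr hiff rfl rfl]
    ring
  rw [sum_congr rfl fun d hd => sum_congr rfl fun r hr => sum_congr rfl fun n hn => e1 d hd r hr n hn]
  rw [sum_congr rfl fun d _ => sum_comm, sum_comm]
  simp_rw [← mul_sum]
  -- Step 2: the inner `(d,r)`-sum for each `n`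
  have hinner : ∀ n ∈ Ico 1 N,
      ∑ d ∈ Ico 1 N, ∑ r ∈ Ico 1 N,
        ((ArithmeticFunction.moebius r).natAbs : ℝ) * (LamC d * LamC r) /
            (((d * r : ℕ) : ℝ) * (Nat.totient r : ℝ)) *
          (if lo / n < ((d * r : ℕ) : ℝ) ∧ ((d * r : ℕ) : ℝ) < θ * (lo / n) then (1 : ℝ) else 0) ≤
        (θ - 1) * (C₃ * C₄) + K * ((n : ℝ) / lo) := by
    intro n hn
    have hn1 : 1 ≤ n := (mem_Ico.mp hn).1
    have hn0 : (0 : ℝ) < n := by exact_mod_cast hn1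
    rcases le_or_gt (n : ℝ) lo with hnlo | hnlo
    · -- `A = lo/n ≥ 1`
      have hA : 1 ≤ lo / n := by rw [le_div_iff₀ hn0]; linarith
      refine (sum_weight_window_le N hA hθ1).trans ?_
      have hlog : (1 + Real.log (θ * (lo / n))) ^ 13 ≤ (1 + Real.log (θ * lo)) ^ 13 := by
        have h1 : 0 ≤ 1 + Real.log (θ * (lo / n)) := by
          have : 0 ≤ Real.log (θ * (lo / n)) := Real.log_nonneg (by nlinarith); linarith
        have h2 : Real.log (θ * (lo / n)) ≤ Real.log (θ * lo) := by
          refine Real.log_le_log (by positivity) ?_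
          have : lo / n ≤ lo := div_le_self hlo0.le (by exact_mod_cast hn1)
          nlinarith
        exact pow_le_pow_left₀ h1 (by linarith) 13
      have e2 : E' * C₆ * (1 + Real.log (θ * (lo / n))) ^ 13 / (lo / n) =
          E' * C₆ * (1 + Real.log (θ * (lo / n))) ^ 13 * ((n : ℝ) / lo) := by
        field_simp
      rw [e2]
      have h3 : E' * C₆ * (1 + Real.log (θ * (lo / n))) ^ 13 ≤ K := by
        rw [hK]
        have : E' * C₆ * (1 + Real.log (θ * (lo / n))) ^ 13 ≤
            E' * C₆ * (1 + Real.log (θ * lo)) ^ 13 := by gcongr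
        linarith
      gcongr
    · -- `n > lo`: only `d = r = 1` can occur
      have hterm : ∀ d ∈ Ico 1 N, ∀ r ∈ Ico 1 N,
          ((ArithmeticFunction.moebius r).natAbs : ℝ) * (LamC d * LamC r) /
              (((d * r : ℕ) : ℝ) * (Nat.totient r : ℝ)) *
            (if lo / n < ((d * r : ℕ) : ℝ) ∧ ((d * r : ℕ) : ℝ) < θ * (lo / n) then (1 : ℝ) else 0) ≤
          if d = 1 ∧ r = 1 then (1 : ℝ) else 0 := by
        intro d hd r hr
        have hd1 : 1 ≤ d := (mem_Ico.mp hd).1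
        have hr1 : 1 ≤ r := (mem_Ico.mp hr).1
        split_ifs with hwin h11
        · obtain ⟨rfl, rfl⟩ := h11
          rw [isMultiplicative_LamC.map_one, isMultiplicative_moebius.map_one]
          simp
        · exfalso
          obtain ⟨-, hup⟩ := hwin
          have hlt2 : ((d * r : ℕ) : ℝ) < 2 := by
            have : θ * (lo / n) < θ := by
              have : lo / n < 1 := by rw [div_lt_one hn0]; exact hnlo
              nlinarith
            linarith
          have hdr1 : d * r < 2 := by exact_mod_cast hlt2
          have : d = 1 ∧ r = 1 := by
            constructor <;> nlinarith
          exact h11 this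
        · rw [mul_zero]; norm_num
        · rw [mul_zero]
      calc _ ≤ ∑ d ∈ Ico 1 N, ∑ r ∈ Ico 1 N, (if d = 1 ∧ r = 1 then (1 : ℝ) else 0) :=
            sum_le_sum fun d hd => sum_le_sum fun r hr => hterm d hd r hr
        _ ≤ 1 := by
            rcases Nat.lt_or_ge N 2 with hN | hN
            · interval_cases N <;> simp
            · have hsplit : ∀ d ∈ Ico 1 N, ∑ r ∈ Ico 1 N, (if d = 1 ∧ r = 1 then (1 : ℝ) else 0) =
                  if d = 1 then 1 else 0 := by
                intro d _
                split_ifs with hd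
                · subst hd
                  simp only [true_and]
                  rw [sum_ite_eq' (Ico 1 N) 1 (fun _ => (1 : ℝ)), if_pos (by rw [mem_Ico]; omega)]
                · simp [hd]
              rw [sum_congr rfl hsplit, sum_ite_eq' (Ico 1 N) 1 (fun _ => (1 : ℝ)),
                if_pos (by rw [mem_Ico]; omega)]
        _ ≤ (θ - 1) * (C₃ * C₄) + K * ((n : ℝ) / lo) := by
            have h1 : 1 ≤ (n : ℝ) / lo := by rw [le_div_iff₀ hlo0]; linarith
            have h2 : 0 ≤ (θ - 1) * (C₃ * C₄) := by
              have : 0 ≤ θ - 1 := by linarith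
              positivity
            have h3 : 1 ≤ K := by rw [hK]; linarith [show 0 ≤ E' * C₆ * (1 + Real.log (θ * lo)) ^ 13 by positivity]
            nlinarith
  -- Step 3: sum over `n`
  have hgC0 : ∀ n, 0 ≤ gC c' D n / (n : ℝ) ^ 2 := fun n => by positivity [gC_nonneg c' D n]
  calc ∑ n ∈ Ico 1 N, gC c' D n / (n : ℝ) ^ 2 *
          ∑ d ∈ Ico 1 N, ∑ r ∈ Ico 1 N,
            ((ArithmeticFunction.moebius r).natAbs : ℝ) * (LamC d * LamC r) /
                (((d * r : ℕ) : ℝ) * (Nat.totient r : ℝ)) *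
              (if lo / n < ((d * r : ℕ) : ℝ) ∧ ((d * r : ℕ) : ℝ) < θ * (lo / n) then (1 : ℝ) else 0)
      ≤ ∑ n ∈ Ico 1 N, gC c' D n / (n : ℝ) ^ 2 * ((θ - 1) * (C₃ * C₄) + K * ((n : ℝ) / lo)) :=
        sum_le_sum fun n hn => mul_le_mul_of_nonneg_left (hinner n hn) (hgC0 n)
    _ = (θ - 1) * (C₃ * C₄) * ∑ n ∈ Ico 1 N, gC c' D n / (n : ℝ) ^ 2 +
          K / lo * ∑ n ∈ Ico 1 N, gC c' D n / n := by
        rw [mul_sum, mul_sum, ← sum_add_distrib]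
        refine sum_congr rfl fun n hn => ?_
        have hn0 : (n : ℝ) ≠ 0 := by exact_mod_cast (by have := (mem_Ico.mp hn).1; omega : n ≠ 0)
        field_simp
    _ ≤ (θ - 1) * (C₃ * C₄) * C₂ + K / lo * ∑ n ∈ Ico 1 N, gC c' D n / n := by
        have hθ0 : 0 ≤ θ - 1 := by linarith
        have hsq : ∑ n ∈ Ico 1 N, gC c' D n / (n : ℝ) ^ 2 ≤ C₂ :=
          (sum_le_sum_of_subset_of_nonneg hsubN fun n _ _ => hgC0 n).trans (sum_gC_div_sq_le c' D N)
        gcongr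

end Diagonal

end Literature.NumberTheory.LFunctions.Zhang2022.ThinWindow
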